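import Literature.AlgebraicGeometry.AbelianSchemes.AbelianSchemeOverSpreadStage                 -- ★ parent (A-p06 (g31)): §1 plumbing + the `[IsProper P.hom]` editions
import Literature.AlgebraicGeometry.Limits.LocalizationRelativeProperSpreadOfProperGenericFibre   -- ★ (s1♭) `exists_stage_isProper_of_isProper_generic`, (hP-𝓜)
import HarnessLib

/-!
# An abelian scheme over `P ×_A Spec K` comes from an abelian scheme over a stage `P ×_A Spec A[1/t]` — for `P` SEPARATED WITH PROPER
# GENERIC FIBRE (no `P → Spec A` proper): EGA IV₃ 8.8.2 (ii), 8.10.5 (xii), IV₄ 17.7.8 relative to `P`; MFK Def. 7.2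

Topic `Literature/AlgebraicGeometry/AbelianSchemes`; namespace `Literature.AlgebraicGeometry.AbelianSchemes.AbelianSchemeOver`.  THEOREMS ONLY (no
definition, no named fact, no instance, no notation, no `sorry`).  Twin of ★ `AbelianSchemeOverSpreadStage` (A-p06 (g31), organ (SP1-e)) with its
standing instance `[IsProper P.hom]` replaced by `[IsSeparated P.hom] (hP : IsProper (pullback.snd P.hom (specOver A K).hom))` — the ONE call of ★
`exists_stage_isProper` (:184) swapped for ★ (s1♭) `exists_stage_isProper_of_isProper_generic`; every other byte of the proofs is the parent՚s.
Cell `hodgecm-mathlib` (D-0151), P6 «MOD programme» (crux hLiu418 = stmt-HodgeConjecture-24832), P-LINE ED. 2 «GLOBAL SPREAD» ROAD (S♭) (desk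
F0P6a-plan (g4) `MEMO-PLINE-ED2-stubSPREAD.v1` §0, organ **(s1-A♭)**): GEN՚s global model `𝓜.total → Spec 𝓞_F` of the thickened record curve is
quasi-compact, quasi-separated, of finite presentation, flat and SEPARATED but NOT proper (it lives over `𝓞_F[1∕N]`); its generic fibre is the
proper `F`-scheme `X` (★ `IntegralModel.isProper_snd_specOver`).  So the E-witness՚s abelian scheme over `X ≅ 𝓜.total ⊗ F` spreads to a stage.
HC_CM is proved only modulo the printed citations until rung 0 closes; nothing here is about HC.

## Statement and proof
VERBATIM ★ `AbelianSchemeOverSpreadStage` §«Statement»∕«Proof» with «PROPER» ↦ «separated with proper generic fibre»: (0) generic flatness,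
(a) total space ★ `exists_stage_isPullback`, (b) ★ `exists_stage_smooth`, (c) ★ (s1♭) `exists_stage_isProper_of_isProper_generic`, (f) ★
`exists_stage_geometricallyConnected`, [(g) ★ `exists_stage_smoothOfRelativeDimension`], (d) ★ `exists_stage_grpObj_isPullback` last.
**`exists_stage_of_generic_of_isProper_generic`**, **`exists_stage_of_generic_of_isOfRelDim_of_isProper_generic`** (universe 0, as the parent).

## References
* [EGAIV3] A. Grothendieck, J. Dieudonné, EGA IV₃ (Publ. Math. IHÉS 28, 1966), Thm. 8.8.2, Thm. 8.10.5 (xii), Thm. 12.2.4.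
* [EGAIV4] EGA IV₄ (Publ. Math. IHÉS 32, 1967), Prop. 17.7.8.
* [MumfordFogartyKirwan1994] D. Mumford, J. Fogarty, F. Kirwan, *Geometric Invariant Theory*, 3rd ed. (1994), Ch. 7 §2 Def. 7.2 (p. 129), Prop. 7.3 (pp. 132–134).
* [GortzWedhorn2020] U. Görtz, T. Wedhorn, *Algebraic Geometry I: Schemes*, 2nd ed. (2020), Section (4.15) (p. 116), Thm. 10.57, Thm. 10.66.
-/

set_option autoImplicit false

noncomputable section

open CategoryTheory CategoryTheory.Limits AlgebraicGeometry MonoidalCategory CartesianMonoidalCategory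
open scoped MonObj

namespace Literature.AlgebraicGeometry.AbelianSchemes

namespace AbelianSchemeOver

open Literature.AlgebraicGeometry.Motives (SchemeOver specOver)
open Literature.AlgebraicGeometry.Limits Literature.AlgebraicGeometry.Limits.LocApprox

set_option backward.isDefEq.respectTransparency false

-- UNIVERSE 0: organ (f) rests on ★ `Morphisms/SmoothConnectedFibreLocusRepresents` (`Scheme.{0}`); the consumer is universe 0.
variable {A : Type} [CommRing A] [IsDomain A] [IsNoetherianRing A] {K : Type} [Field K] [Algebra A K] [IsFractionRing A K]
variable {P : SchemeOver A} [QuasiCompact P.hom] [QuasiSeparated P.hom] [LocallyOfFinitePresentation P.hom] [IsSeparated P.hom]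
  (hP : IsProper (pullback.snd P.hom (specOver A K).hom))

include hP in
/-- **The total space, smoothness, properness and geometric connectedness of the fibres come from a stage.**  For an abelian scheme
`𝒜` over `P ⊗ Spec K` (`P` quasi-compact, quasi-separated, of finite presentation and SEPARATED over the Noetherian domain `A` WITH
PROPER GENERIC FIBRE `P ⊗ Spec K → Spec K` (`hP`), `K = Frac A`) there are a stage `t`, a quasi-compact quasi-separated `Y → (P ⊗ D(t)).left` locally of finite presentation which is smooth,
proper and with geometrically connected fibres, and a cartesian square `G : 𝒜.X → Y` over the leg `P ⊗ Spec K → P ⊗ D(t)`: the total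
space by (a) ★ `exists_stage_isPullback`, then smoothness (b), properness (c, ★ (s1♭) `exists_stage_isProper_of_isProper_generic`) and geometric
connectedness (f) at successively
finer stages, each preserved by the later restrictions (§1).  (`private`: statement-identical to the parent՚s ★
`exists_stage_smooth_isProper_geometricallyConnected` up to the hypothesis swap; the public heads are the two theorems below.)
[cite: EGAIV3, Thm. 8.8.2 (ii) and Thm. 8.10.5 (xii)]
[cite: EGAIV4, Prop. 17.7.8 (ii)] -/
private theorem exists_stage_smooth_isProper_geometricallyConnected_of_isProper_generic (𝒜 : AbelianSchemeOver (P ⊗ specOver A K).left) :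
    ∃ (t : Idx (nonZeroDivisors A)) (Y : Over (P ⊗ (baseDiagram (nonZeroDivisors A)).obj t).left) (G : 𝒜.X.left ⟶ Y.left),
      QuasiCompact Y.hom ∧ QuasiSeparated Y.hom ∧ LocallyOfFinitePresentation Y.hom ∧ Smooth Y.hom ∧ IsProper Y.hom ∧
        GeometricallyConnected Y.hom ∧ Flat (pullback.snd P.hom ((baseDiagram (nonZeroDivisors A)).obj t).hom) ∧
          IsPullback G 𝒜.X.hom Y.hom (P ◁ (baseCone (nonZeroDivisors A) K).π.app t).left := by
  haveI := 𝒜.isProper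
  haveI := 𝒜.isSmooth
  haveI := 𝒜.geometricallyConnected
  -- generic flatness: `P ⊗ D(s_P) → D(s_P)` is flat for some stage `s_P`
  obtain ⟨sP, hsP, hflat⟩ := exists_forall_flat_snd P
  have hflat₀ : Flat (pullback.snd P.hom ((baseDiagram (nonZeroDivisors A)).obj ⟨sP, hsP⟩).hom) :=
    hflat sP (dvd_refl sP) (loc (nonZeroDivisors A) ⟨sP, hsP⟩)
  -- (a) the total space comes from a stage; refine below `s_P`
  obtain ⟨t₀', Y₀', G₀', hqc', hqs', hlfp', pb₀'⟩ := exists_stage_isPullback (nonZeroDivisors A) 𝒜.X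
  haveI := hqc'
  haveI := hqs'
  haveI := hlfp'
  obtain ⟨t₀, ⟨ρ₀⟩, ⟨ρP⟩⟩ := exists_hom₂ (nonZeroDivisors A) t₀' (⟨sP, hsP⟩ : Idx (nonZeroDivisors A))
  have hflatP₀ : Flat (pullback.snd P.hom ((baseDiagram (nonZeroDivisors A)).obj t₀).hom) := flat_snd_baseDiagram_of_hom ρP hflat₀
  obtain ⟨G₀, -, pb₀⟩ := exists_isPullback_pullback_snd ρ₀ 𝒜.X Y₀' G₀' pb₀'
  let Y₀ : Over (P ⊗ (baseDiagram (nonZeroDivisors A)).obj t₀).left :=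
    Over.mk (pullback.snd Y₀'.hom (P ◁ (baseDiagram (nonZeroDivisors A)).map ρ₀).left)
  haveI : QuasiCompact Y₀.hom := inferInstanceAs (QuasiCompact (pullback.snd _ _))
  haveI : QuasiSeparated Y₀.hom := inferInstanceAs (QuasiSeparated (pullback.snd _ _))
  haveI : LocallyOfFinitePresentation Y₀.hom := inferInstanceAs (LocallyOfFinitePresentation (pullback.snd _ _))
  replace pb₀ : IsPullback G₀ 𝒜.X.hom Y₀.hom (P ◁ leg (nonZeroDivisors A) K t₀).left := pb₀
  -- (b) smooth at a finer stage
  have hsm₀ : Smooth (pullback.snd Y₀.hom (P ◁ leg (nonZeroDivisors A) K t₀).left) :=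
    of_isPullback_of_isPullback pb₀ (IsPullback.of_hasPullback _ _) 𝒜.isSmooth
  obtain ⟨t₁, ρ₁, hsm₁⟩ := exists_stage_smooth (B := K) P Y₀ hsm₀
  obtain ⟨G₁, -, pb₁⟩ := exists_isPullback_pullback_snd ρ₁ 𝒜.X Y₀ G₀ pb₀
  let Y₁ : Over (P ⊗ (baseDiagram (nonZeroDivisors A)).obj t₁).left :=
    Over.mk (pullback.snd Y₀.hom (P ◁ (baseDiagram (nonZeroDivisors A)).map ρ₁).left)
  haveI : Smooth Y₁.hom := hsm₁
  haveI : QuasiCompact Y₁.hom := inferInstanceAs (QuasiCompact (pullback.snd _ _))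
  haveI : QuasiSeparated Y₁.hom := inferInstanceAs (QuasiSeparated (pullback.snd _ _))
  haveI : LocallyOfFinitePresentation Y₁.hom := inferInstanceAs (LocallyOfFinitePresentation (pullback.snd _ _))
  replace pb₁ : IsPullback G₁ 𝒜.X.hom Y₁.hom (P ◁ leg (nonZeroDivisors A) K t₁).left := pb₁
  -- (c) proper at a finer stage (`P` separated with proper generic fibre: ★ (s1♭))
  have hpr₁ : IsProper (pullback.snd Y₁.hom (P ◁ leg (nonZeroDivisors A) K t₁).left) :=
    of_isPullback_of_isPullback pb₁ (IsPullback.of_hasPullback _ _) 𝒜.isProper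
  obtain ⟨t₂, ρ₂, hpr₂⟩ := exists_stage_isProper_of_isProper_generic P hP Y₁ hpr₁
  obtain ⟨G₂, -, pb₂⟩ := exists_isPullback_pullback_snd ρ₂ 𝒜.X Y₁ G₁ pb₁
  let Y₂ : Over (P ⊗ (baseDiagram (nonZeroDivisors A)).obj t₂).left :=
    Over.mk (pullback.snd Y₁.hom (P ◁ (baseDiagram (nonZeroDivisors A)).map ρ₂).left)
  haveI : IsProper Y₂.hom := hpr₂
  haveI : Smooth Y₂.hom := inferInstanceAs (Smooth (pullback.snd _ _))
  replace pb₂ : IsPullback G₂ 𝒜.X.hom Y₂.hom (P ◁ leg (nonZeroDivisors A) K t₂).left := pb₂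
  -- (f) geometrically connected fibres at a finer stage
  have hgc₂ : GeometricallyConnected (pullback.snd Y₂.hom (P ◁ leg (nonZeroDivisors A) K t₂).left) :=
    of_isPullback_of_isPullback pb₂ (IsPullback.of_hasPullback _ _) 𝒜.geometricallyConnected
  haveI := isLocallyNoetherian_tensorObj_baseDiagram_left P t₂
  obtain ⟨t₃, ρ₃, hgc₃⟩ := exists_stage_geometricallyConnected P Y₂ hgc₂
  obtain ⟨G₃, -, pb₃⟩ := exists_isPullback_pullback_snd ρ₃ 𝒜.X Y₂ G₂ pb₂
  refine ⟨t₃, Over.mk (pullback.snd Y₂.hom (P ◁ (baseDiagram (nonZeroDivisors A)).map ρ₃).left), G₃,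
    inferInstanceAs (QuasiCompact (pullback.snd _ _)), inferInstanceAs (QuasiSeparated (pullback.snd _ _)),
    inferInstanceAs (LocallyOfFinitePresentation (pullback.snd _ _)), inferInstanceAs (Smooth (pullback.snd _ _)),
    inferInstanceAs (IsProper (pullback.snd _ _)), hgc₃,
    flat_snd_baseDiagram_of_hom ρ₃ (flat_snd_baseDiagram_of_hom ρ₂ (flat_snd_baseDiagram_of_hom ρ₁ hflatP₀)), pb₃⟩

include hP in
/-- **An abelian scheme over the generic fibre `P ⊗ Spec K` of a quasi-compact quasi-separated separated `A`-scheme `P` of finite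
presentation WITH PROPER GENERIC FIBRE (`A` a Noetherian domain, `K = Frac A`) is the base change of an abelian scheme over a stage `P ⊗ D(t)`**, in the sense of
MFK Def. 7.2 (★ `IsBaseChangeVia`: cartesian square of total spaces compatible with unit and law).  Assembly of the SP1 organs: the
smooth proper stage model with geometrically connected fibres (`exists_stage_smooth_isProper_geometricallyConnected_of_isProper_generic`), then the group
law descends to a finer stage compatibly (d), the three properties riding the last restriction.  EXPORTED in addition (unlike the parent): the
stage is FLAT, `P ⊗ D(t) → D(t)` flat — the standing instance of ★ (s1-ι) `exists_stage_ringAction` ∕ ★ `exists_stage_monHom` ∕ ★ (s2-λ″).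
[cite: EGAIV3, Thm. 8.8.2 (ii) and Thm. 8.10.5 (xii)] [cite: EGAIV4, Prop. 17.7.8 (ii)]
[cite: MumfordFogartyKirwan1994, Ch. 7 §2 Definition 7.2 (p. 129)] -/
theorem exists_stage_of_generic_of_isProper_generic (𝒜 : AbelianSchemeOver (P ⊗ specOver A K).left) :
    ∃ (t : Idx (nonZeroDivisors A)) (𝒜ₜ : AbelianSchemeOver (P ⊗ (baseDiagram (nonZeroDivisors A)).obj t).left)
      (G : 𝒜.X.left ⟶ 𝒜ₜ.X.left), 𝒜.IsBaseChangeVia 𝒜ₜ (P ◁ (baseCone (nonZeroDivisors A) K).π.app t).left G ∧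
        Flat (pullback.snd P.hom ((baseDiagram (nonZeroDivisors A)).obj t).hom) := by
  obtain ⟨t₃, Y₃, G₃, hqc, hqs, hlfp, hsm₃, hpr₃, hgc₃, hflat₃, pb₃⟩ := exists_stage_smooth_isProper_geometricallyConnected_of_isProper_generic hP 𝒜
  haveI := hqc
  haveI := hqs
  haveI := hlfp
  haveI := hsm₃
  haveI := hpr₃
  haveI := hflat₃
  -- (d) the group law at a finer stage, compatibly
  obtain ⟨t, ρ, Yₜ, _, G, R, w, hR, -, pb, hη, hμ⟩ := exists_stage_grpObj_isPullback 𝒜.X Y₃ G₃ pb₃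
  have hsm : Smooth Yₜ.hom := MorphismProperty.of_isPullback hR hsm₃
  have hpr : IsProper Yₜ.hom := MorphismProperty.of_isPullback hR hpr₃
  have hgc : GeometricallyConnected Yₜ.hom := MorphismProperty.of_isPullback hR hgc₃
  exact ⟨t, ⟨Yₜ, hpr, hsm, hgc⟩, G, ⟨w, pb, hη, hμ⟩, flat_snd_baseDiagram_of_hom ρ hflat₃⟩

include hP in
/-- **The same with the relative dimension** (MFK Def. 7.2 (i): «of dimension `g`»): if `𝒜` is of relative dimension `g` over
`P ⊗ Spec K`, the stage model may be taken of relative dimension `g` over `P ⊗ D(t)` (organ (g): the relative dimension of the smooth stage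
model spreads from the generic fibre before the group law is descended, and rides the last restriction).  This is the `hg` input of ★ SP2
`LevelStructure.exists_stage_of_generic`; the stage flatness is exported as well.  [cite: EGAIV4, Prop. 17.7.8 (ii)] [cite: MumfordFogartyKirwan1994, Ch. 7 §2 Definition 7.2 (p. 129)] -/
theorem exists_stage_of_generic_of_isOfRelDim_of_isProper_generic (𝒜 : AbelianSchemeOver (P ⊗ specOver A K).left) {g : ℕ} (hg : 𝒜.IsOfRelDim g) :
    ∃ (t : Idx (nonZeroDivisors A)) (𝒜ₜ : AbelianSchemeOver (P ⊗ (baseDiagram (nonZeroDivisors A)).obj t).left)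
      (G : 𝒜.X.left ⟶ 𝒜ₜ.X.left), 𝒜.IsBaseChangeVia 𝒜ₜ (P ◁ (baseCone (nonZeroDivisors A) K).π.app t).left G ∧ 𝒜ₜ.IsOfRelDim g ∧
        Flat (pullback.snd P.hom ((baseDiagram (nonZeroDivisors A)).obj t).hom) := by
  obtain ⟨t₃, Y₃, G₃, hqc, hqs, hlfp, hsm₃, hpr₃, hgc₃, hflat₃, pb₃⟩ := exists_stage_smooth_isProper_geometricallyConnected_of_isProper_generic hP 𝒜
  haveI := hqc
  haveI := hqs
  haveI := hlfp
  haveI := hsm₃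
  haveI := hpr₃
  haveI := hgc₃
  -- (g) relative dimension `g` at a finer stage
  haveI := smoothOfRelativeDimension_isStableUnderBaseChange (n := g)
  have hrd₃ : SmoothOfRelativeDimension g (pullback.snd Y₃.hom (P ◁ leg (nonZeroDivisors A) K t₃).left) :=
    of_isPullback_of_isPullback pb₃ (IsPullback.of_hasPullback _ _) ((𝒜.isOfRelDim_iff g).1 hg)
  obtain ⟨t₄, ρ₄, hrd₄⟩ := exists_stage_smoothOfRelativeDimension K P Y₃ g hrd₃
  obtain ⟨G₄, -, pb₄⟩ := exists_isPullback_pullback_snd ρ₄ 𝒜.X Y₃ G₃ pb₃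
  let Y₄ : Over (P ⊗ (baseDiagram (nonZeroDivisors A)).obj t₄).left :=
    Over.mk (pullback.snd Y₃.hom (P ◁ (baseDiagram (nonZeroDivisors A)).map ρ₄).left)
  haveI : QuasiCompact Y₄.hom := inferInstanceAs (QuasiCompact (pullback.snd _ _))
  haveI : QuasiSeparated Y₄.hom := inferInstanceAs (QuasiSeparated (pullback.snd _ _))
  haveI : LocallyOfFinitePresentation Y₄.hom := inferInstanceAs (LocallyOfFinitePresentation (pullback.snd _ _))
  have hsm₄ : Smooth Y₄.hom := inferInstanceAs (Smooth (pullback.snd _ _))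
  have hpr₄ : IsProper Y₄.hom := inferInstanceAs (IsProper (pullback.snd _ _))
  have hgc₄ : GeometricallyConnected Y₄.hom := inferInstanceAs (GeometricallyConnected (pullback.snd _ _))
  replace hrd₄ : SmoothOfRelativeDimension g Y₄.hom := hrd₄
  replace pb₄ : IsPullback G₄ 𝒜.X.hom Y₄.hom (P ◁ leg (nonZeroDivisors A) K t₄).left := pb₄
  haveI : Flat (pullback.snd P.hom ((baseDiagram (nonZeroDivisors A)).obj t₄).hom) := flat_snd_baseDiagram_of_hom ρ₄ hflat₃
  -- (d) the group law at a finer stage, compatibly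
  obtain ⟨t, ρ, Yₜ, _, G, R, w, hR, -, pb, hη, hμ⟩ := exists_stage_grpObj_isPullback 𝒜.X Y₄ G₄ pb₄
  have hsm : Smooth Yₜ.hom := MorphismProperty.of_isPullback hR hsm₄
  have hpr : IsProper Yₜ.hom := MorphismProperty.of_isPullback hR hpr₄
  have hgc : GeometricallyConnected Yₜ.hom := MorphismProperty.of_isPullback hR hgc₄
  have hrd : SmoothOfRelativeDimension g Yₜ.hom := MorphismProperty.of_isPullback hR hrd₄
  exact ⟨t, ⟨Yₜ, hpr, hsm, hgc⟩, G, ⟨w, pb, hη, hμ⟩, (AbelianSchemeOver.isOfRelDim_iff _ g).2 hrd, flat_snd_baseDiagram_of_hom ρ ‹_›⟩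

end AbelianSchemeOver

end Literature.AlgebraicGeometry.AbelianSchemes

end
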